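import Literature.NumberTheory.EllipticCurves.ModularCurve
import Summits.BirchSwinnertonDyer.BirchSwinnertonDyer.Theorems.SchneiderFreeAdditiveX3GordTwoBranchIMCDivOfKY
import Summits.BirchSwinnertonDyer.Rank1Residual.X11b.InterpolationCharacterSupplyShapes
import Summits.BirchSwinnertonDyer.Rank1Residual.Partition.IrreducibleOverQuadraticField
import Literature.NumberTheory.EllipticCurves.BurungaleCastellaSkinner2025.BDPMainConjecture
import HarnessLib

/-!
# Route `UniversalToricDescent`, crux #3 `TwinSplitIMCAtThree` (item stmt-BirchSwinnertonDyer-20214):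
# conjunct (i) (a BDP frame exists, with `μ = 0`) at `p = 3` for EVERY twin of GOOD reduction — ordinary
# or supersingular —, and the period-transport lemmas behind the `∃`-frame reading of clause (ii)

Seat `bsd-wall-utd-p2` (D-0131 (3) MIDDLE tier; memo `HOME/bsd-wall/bsd-wall-utd-p2/SUPSET-AT3-v1.md`).
Kernel-checked, sorry-free; §1 is CONDITIONAL on ONE named refereed fact taken as a hypothesis
(`h422` = `BurungaleCastellaSkinner2025.prop422_exists_isBDPLFunction_mu_eq_zero`, IMRN 2025 rnaf082
Prop. 4.2.2 = Hsieh 2014 Thm. B, printed for "good reduction at `p > 2`" with (disc), (Heeg), (spl),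
(irr_K) and NO ordinarity — `[corpus: paper:arxiv-2405.00270 p0008–p0009]`); §2 is unconditional.

* §1 `exists_frame_mu_eq_zero_of_good` — `W′` GOOD at `3` (census buckets A = 745 and C = 603 of the
  2 023 twin classes; B = 675 has only `3 ∥ N′` twins and is not touched), `ρ̄_{W′,3}` onto, `K`
  imaginary quadratic with the Heegner hypothesis for `N′` and (disc), `κ` anticyclotomic with
  topological generator `γ`, `3 = 𝔭𝔭′`, `ι′` inducing `𝔭`: a frame `(Ω_K ≠ 0, Ω_p ∈ R₀ˣ, L′)` of
  `f_{W′}` at `(ι′, 𝔭)` with `μ(L′) = 0` (some coefficient of `L′` is a unit of `R₀`); hence conjunct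
  (i) of the crux verbatim (`crux_conjunct_one_of_good`) and `L′ ≠ 0`.
* §2 (no named fact) the two transport lemmas that make an `∃`-frame statement of clause (ii) as
  strong as the kernel needs (finding F2, repair (B) of the memo): `hasValueAt_zero_of_frame_of_frame`
  — the value at `𝟙` moves between ANY two frames of the same `(ι′, 𝔭, κ, γ, f)` with non-zero periods
  (V1RIG, `X11b.constantCoeff_eq_of_isBDPLFunction_of_isAnticyclotomic`, unconditional at odd `p`);
  `mem_charIdeal_forall_of_exists_at_periods` — at FIXED periods "some `L` of the frame lies in an
  ideal" = "every `L` of the frame lies in it" with NO supply binder (the supply is the tree's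
  `X11b.exists_interpolationSupply` at odd `p`).

Beyond-print: NO (print wired to the crux currency + tree rigidity). `--supports stmt-BirchSwinnertonDyer-20214`.

References: [BurungaleCastellaSkinner2025] Prop. 4.2.2 (arXiv:2405.00270v2 pp. 8–9); [Hsieh2014]
Thm. B; [Castella2018] Thm. 3.1; [CastellaHsieh2018] §3.3.
-/

noncomputable section

open scoped Classical

set_option linter.dupNamespace false
set_option autoImplicit false

namespace Summit.BirchSwinnertonDyer.BirchSwinnertonDyer.Theorems.UniversalToricDescentTwinSplit

open Filter Topology WeierstrassCurve NumberField IsDedekindDomain Field PowerSeries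
  Literature.NumberTheory.EllipticCurves
  Literature.NumberTheory.EllipticCurves.ModularForms
  Literature.NumberTheory.EllipticCurves.Rank1Residual
  Literature.NumberTheory.GaloisRepresentations
  Summit.BirchSwinnertonDyer.Rank1Residual
  Summit.BirchSwinnertonDyer.Rank1Residual.X11b
  Summit.BirchSwinnertonDyer.Rank1Residual.X11b.Halves
  Summit.BirchSwinnertonDyer.BirchSwinnertonDyer.Theorems.SchneiderFree

/-! ## §1 Conjunct (i) with `μ = 0` for every twin of good reduction at `3` (BCS 2025 Prop. 4.2.2 = Hsieh) -/

/-- **A BDP frame with `μ = 0` at `p = 3` for a twin of GOOD reduction (ordinary or supersingular).**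
Data: `W′/ℚ` elliptic, good at `3`, `ρ̄_{W′,3}` onto; `Dt′` a modular parametrisation datum of level
`N′`; `K` imaginary quadratic with the Heegner hypothesis for `N′` and (disc) `D_K` odd, `D_K ≠ −3`;
`κ` anticyclotomic with topological generator `γ`; `𝔭 ∋ 3` of degree one, `𝔭′ ∋ 3`, `𝔭′ ≠ 𝔭`
(only used to read off that `3` splits); `ι′` inducing `𝔭`. Conclusion: a frame
`(Ω_K ≠ 0, Ω_p ∈ R₀ˣ, L′)` with `IsBDPLFunction ι′ 𝔭 κ γ Dt′.f Ω_K Ω_p L′` and a UNIT coefficient of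
`L′`. CONDITIONAL on the named fact `h422`.
[cite: BurungaleCastellaSkinner2025, Prop. 4.2.2 (§4.2, pp. 8–9 of arXiv:2405.00270v2)]
[cite: Hsieh2014, Thm. B (the source of `μ = 0`, as cited by BCS)] -/
theorem exists_frame_mu_eq_zero_of_good
    (h422 : BurungaleCastellaSkinner2025.prop422_exists_isBDPLFunction_mu_eq_zero)
    (W' : WeierstrassCurve ℚ) [W'.IsElliptic] (N' : ℕ) [NeZero N']
    (K : Type) [Field K] [NumberField K] (Dt' : ModularParametrizationData W' N')
    (hgood : W'.HasGoodReductionAtPrime 3) (hsurj : W'.HasSurjectiveModNGaloisRep 3)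
    (hK : IsImaginaryQuadratic K) (hH : SatisfiesHeegnerHypothesis N' K)
    (hodd : Odd (NumberField.discr K)) (hd3 : NumberField.discr K ≠ -3)
    (κ : ZpExtension K 3) (hκ : κ.IsAnticyclotomic) (γ : absoluteGaloisGroup K)
    [hγ : Fact (κ.IsTopGenerator γ)]
    (𝔭 : HeightOneSpectrum (𝓞 K)) (h𝔭 : ((3 : ℕ) : 𝓞 K) ∈ 𝔭.asIdeal)
    (he : 𝔭.asIdeal.ramificationIdx (𝓞 ℚ) = 1) (hf : 𝔭.asIdeal.inertiaDeg (𝓞 ℚ) = 1)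
    (ι' : PadicAlgCl 3 ≃+* ℂ) (hι' : BranchInducesPrime 3 ι' 𝔭) :
    ∃ (ΩK : ℂ) (Ωp : (unrIntegers 3)ˣ) (L' : UnrSeries 3),
      ΩK ≠ 0 ∧ IsBDPLFunction ι' 𝔭 κ γ Dt'.f ΩK ((Ωp : unrIntegers 3) : ℂ_[3]) L' ∧
      ∃ k : ℕ, IsUnit (PowerSeries.coeff k L') := by
  have h2 : Module.finrank ℚ K = 2 := hK.1
  have hspl : ((Ideal.span {((3 : ℕ) : ℤ)}).primesOver (𝓞 K)).ncard = 2 :=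
    ncard_primesOver_eq_two_of_degreeOne h2 h𝔭 he hf
  have hirrK : (W'.baseChange K).HasIrreducibleModPGaloisRep 3 := irrK_of_surj W' 3 hsurj K h2
  exact h422 ι' W' K 𝔭 κ γ Dt'.isNewformOf (by decide) hgood hK hH hspl hodd hd3 hirrK h𝔭 hι' hκ
    hγ.out

/-- **Crux #3's conjunct (i) verbatim for every twin of good reduction at `3`** (`Ω_p ∈ R₀ˣ` has norm
`1`, hence is non-zero in `ℂ_3`). CONDITIONAL on `h422`.
[cite: BurungaleCastellaSkinner2025, Prop. 4.2.2 (§4.2, pp. 8–9 of arXiv:2405.00270v2)] -/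
theorem crux_conjunct_one_of_good
    (h422 : BurungaleCastellaSkinner2025.prop422_exists_isBDPLFunction_mu_eq_zero)
    (W' : WeierstrassCurve ℚ) [W'.IsElliptic] (N' : ℕ) [NeZero N']
    (K : Type) [Field K] [NumberField K] (Dt' : ModularParametrizationData W' N')
    (hgood : W'.HasGoodReductionAtPrime 3) (hsurj : W'.HasSurjectiveModNGaloisRep 3)
    (hK : IsImaginaryQuadratic K) (hH : SatisfiesHeegnerHypothesis N' K)
    (hodd : Odd (NumberField.discr K)) (hd3 : NumberField.discr K ≠ -3)
    (κ : ZpExtension K 3) (hκ : κ.IsAnticyclotomic) (γ : absoluteGaloisGroup K)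
    [Fact (κ.IsTopGenerator γ)]
    (𝔭 : HeightOneSpectrum (𝓞 K)) (h𝔭 : ((3 : ℕ) : 𝓞 K) ∈ 𝔭.asIdeal)
    (he : 𝔭.asIdeal.ramificationIdx (𝓞 ℚ) = 1) (hf : 𝔭.asIdeal.inertiaDeg (𝓞 ℚ) = 1)
    (ι' : PadicAlgCl 3 ≃+* ℂ) (hι' : BranchInducesPrime 3 ι' 𝔭) :
    ∃ (ΩK : ℂ) (Ωp : ℂ_[3]) (L' : UnrSeries 3), ΩK ≠ 0 ∧ Ωp ≠ 0 ∧
      IsBDPLFunction ι' 𝔭 κ γ Dt'.f ΩK Ωp L' := by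
  obtain ⟨ΩK, Ωp, L, hΩK, hL, -⟩ := exists_frame_mu_eq_zero_of_good h422 W' N' K Dt' hgood hsurj
    hK hH hodd hd3 κ hκ γ 𝔭 h𝔭 he hf ι' hι'
  refine ⟨ΩK, ((Ωp : unrIntegers 3) : ℂ_[3]), L, hΩK, ?_, hL⟩
  intro h0
  have h1 := norm_coe_units_unrIntegers 3 Ωp
  rw [h0, norm_zero] at h1
  exact zero_ne_one h1

/-- **`μ = 0` forces `L′ ≠ 0`**, and by fixed-period frame rigidity (unconditional at the odd prime `3`)
EVERY series with the same interpolation data as the `μ = 0` frame is that series, hence non-zero.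
CONDITIONAL on `h422`. [cite: BurungaleCastellaSkinner2025, Prop. 4.2.2 (§4.2, pp. 8–9 of arXiv:2405.00270v2)]
[cite: Castella2018, Thm. 3.1 (arXiv:1704.06608 p. 9) (the interpolation property pinning `L`)] -/
theorem exists_frame_forall_ne_zero_of_good
    (h422 : BurungaleCastellaSkinner2025.prop422_exists_isBDPLFunction_mu_eq_zero)
    (W' : WeierstrassCurve ℚ) [W'.IsElliptic] (N' : ℕ) [NeZero N']
    (K : Type) [Field K] [NumberField K] (Dt' : ModularParametrizationData W' N')
    (hgood : W'.HasGoodReductionAtPrime 3) (hsurj : W'.HasSurjectiveModNGaloisRep 3)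
    (hK : IsImaginaryQuadratic K) (hH : SatisfiesHeegnerHypothesis N' K)
    (hodd : Odd (NumberField.discr K)) (hd3 : NumberField.discr K ≠ -3)
    (κ : ZpExtension K 3) (hκ : κ.IsAnticyclotomic) (γ : absoluteGaloisGroup K)
    [hγ : Fact (κ.IsTopGenerator γ)]
    (𝔭 : HeightOneSpectrum (𝓞 K)) (h𝔭 : ((3 : ℕ) : 𝓞 K) ∈ 𝔭.asIdeal)
    (he : 𝔭.asIdeal.ramificationIdx (𝓞 ℚ) = 1) (hf : 𝔭.asIdeal.inertiaDeg (𝓞 ℚ) = 1)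
    (ι' : PadicAlgCl 3 ≃+* ℂ) (hι' : BranchInducesPrime 3 ι' 𝔭) :
    ∃ (ΩK : ℂ) (Ωp : (unrIntegers 3)ˣ), ΩK ≠ 0 ∧
      (∃ L', IsBDPLFunction ι' 𝔭 κ γ Dt'.f ΩK ((Ωp : unrIntegers 3) : ℂ_[3]) L') ∧
      ∀ L'' : UnrSeries 3, IsBDPLFunction ι' 𝔭 κ γ Dt'.f ΩK ((Ωp : unrIntegers 3) : ℂ_[3]) L'' →
        L'' ≠ 0 := by
  obtain ⟨ΩK, Ωp, L, hΩK, hL, k, hk⟩ := exists_frame_mu_eq_zero_of_good h422 W' N' K Dt' hgood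
    hsurj hK hH hodd hd3 κ hκ γ 𝔭 h𝔭 he hf ι' hι'
  refine ⟨ΩK, Ωp, hΩK, ⟨L, hL⟩, fun L'' hL'' h0 ↦ ?_⟩
  have heq : L = L'' :=
    isBDPLFunction_unique_of_isAnticyclotomic (p := 3) (by decide) hK hκ hγ.out hL hL''
  rw [heq, h0, map_zero] at hk
  exact not_isUnit_zero hk

/-! ## §2 Period transport behind the `∃`-frame reading of clause (ii) (no named fact) -/

/-- **The value at `𝟙` moves between ANY two frames** of the same `(ι′, 𝔭, κ, γ, f)` with non-zero
periods (`K` imaginary quadratic, `κ` anticyclotomic with topological generator `γ`, `p = 3` odd): if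
`L.HasValueAt 0 v` then `L₀.HasValueAt 0 v`. This is V1RIG
(`X11b.constantCoeff_eq_of_isBDPLFunction_of_isAnticyclotomic`) read through
`UnrSeries.hasValueAt_zero`; it is the one line by which the kernel (item 20390) reads crux #4's value
formula on the frame delivered by an `∃`-frame statement of clause (ii).
[cite: Castella2018, Thm. 3.1–3.2 (arXiv:1704.06608 pp. 8–9)] -/
theorem hasValueAt_zero_of_frame_of_frame {K : Type} [Field K] [NumberField K] {N : ℕ}
    (ι : PadicAlgCl 3 ≃+* ℂ) (𝔭 : HeightOneSpectrum (𝓞 K)) (κ : ZpExtension K 3)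
    (γ : absoluteGaloisGroup K) (hK : IsImaginaryQuadratic K) (hκ : κ.IsAnticyclotomic)
    (hγ : κ.IsTopGenerator γ) (f : CuspForm (CongruenceSubgroup.Gamma0 N) 2)
    {ΩK ΩK₀ : ℂ} {Ωp Ωp₀ : ℂ_[3]} {L L₀ : UnrSeries 3} (hΩK : ΩK ≠ 0) (hΩK₀ : ΩK₀ ≠ 0)
    (hΩp : Ωp ≠ 0) (hΩp₀ : Ωp₀ ≠ 0) (hL : IsBDPLFunction ι 𝔭 κ γ f ΩK Ωp L)
    (hL₀ : IsBDPLFunction ι 𝔭 κ γ f ΩK₀ Ωp₀ L₀) {v : ℂ_[3]} (hv : L.HasValueAt 0 v) :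
    L₀.HasValueAt 0 v := by
  have hc : PowerSeries.constantCoeff L₀ = PowerSeries.constantCoeff L :=
    constantCoeff_eq_of_isBDPLFunction_of_isAnticyclotomic (p := 3) (by decide) K N ι 𝔭 κ γ hK hκ hγ
      f ΩK ΩK₀ Ωp Ωp₀ L L₀ hΩK hΩK₀ hΩp hΩp₀ hL hL₀
  rw [UnrSeries.eq_constantCoeff_of_hasValueAt_zero hv, ← hc]
  exact L₀.hasValueAt_zero

/-- **At fixed periods, membership of ONE series of the frame in an ideal is membership of EVERY series
of the frame**, with NO supply binder at the odd prime `3` (`K` imaginary quadratic, `κ` anticyclotomic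
with topological generator `γ`): `X11b.isBDPLFunction_unique_of_isAnticyclotomic`. In particular the
`⊇`-half landed at the printed frame (`exists_frame_isTorsion_mem_charIdeal_of_goodOrd`) holds for every
`L″` with the printed periods. [cite: Castella2018, Thm. 3.1 (arXiv:1704.06608 p. 9)] -/
theorem mem_ideal_forall_of_exists_at_periods {K : Type} [Field K] [NumberField K] {N : ℕ}
    (ι : PadicAlgCl 3 ≃+* ℂ) (𝔭 : HeightOneSpectrum (𝓞 K)) (κ : ZpExtension K 3)
    (γ : absoluteGaloisGroup K) (hK : IsImaginaryQuadratic K) (hκ : κ.IsAnticyclotomic)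
    (hγ : κ.IsTopGenerator γ) (f : CuspForm (CongruenceSubgroup.Gamma0 N) 2)
    {ΩK : ℂ} {Ωp : ℂ_[3]} (I : Ideal (UnrSeries 3))
    (hex : ∃ L, IsBDPLFunction ι 𝔭 κ γ f ΩK Ωp L ∧ L ∈ I) {L' : UnrSeries 3}
    (hL' : IsBDPLFunction ι 𝔭 κ γ f ΩK Ωp L') : L' ∈ I := by
  obtain ⟨L, hL, hmem⟩ := hex
  rwa [isBDPLFunction_unique_of_isAnticyclotomic (p := 3) (by decide) hK hκ hγ hL hL'] at hmem

end Summit.BirchSwinnertonDyer.BirchSwinnertonDyer.Theorems.UniversalToricDescentTwinSplit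

end
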